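import Summits.CriticalPhenomena.PercolationContinuityZ3.Theorems.PercNearOneGluingNoHeavyConstsCrossReachMarkerPinnedExchanges
import Summits.CriticalPhenomena.PercolationContinuityZ3.Theorems.PercNearOneGluingNoHeavyConstsCrossReachMarkerPinnedExchangesM1
import Summits.CriticalPhenomena.PercolationContinuityZ3.Theorems.PercNearOneGluingNoHeavyConstsCrossReachMarkerSaturated
import Summits.CriticalPhenomena.PercolationContinuityZ3.Theorems.PercNearOneGluingNoHeavyConstsCrossReachMarkerSaturatedEdge
import HarnessLib

/-!
# CROSS at the reach marker `u = z`: both members on BOTH marker quadrants `U ⊆ {s↔y}` and `U ⊇ {s↔y}`, unconditionally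
# (PAPER-2 track (ii), seat `prim-consts-2`, gen 21 — assembly file)

builds on p205010 (kernel theorem, internal audit signed; external expert review pending).  Support file (`--supports
stmt-CriticalPhenomena-4575`); theorems only, no sorries, standard axioms.  Memo `run/shared/lean/prim/consts/FROM-prim-consts-2-g21-GIBBS-ORBIT.md` §3.

Assembles `…CrossReachMarkerPinnedExchanges{,M1}.lean` (both `u = z` members of `Consts.CrossRel` on `U ⊆ {s↔y}`, unconditional) and
`…CrossReachMarkerSaturated.lean` (the quadrant `U ⊇ {s↔y}` from the corner `U = {s↔y}`):
* `Consts.crossRel_reach_of_markerSaturated` — **THEOREM: for every weighted graph, all `s, y, z, X`, every monotone vertex-up-family `𝒰` with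
  `y ∈ S → 𝒰 S` and every `F` reading `1{𝒰(V(C_s))}`: `M₁(F) ≥ 0` and `M₂(F) ≥ 0` at `u = z`.**
* `Consts.crossRel_edge_of_markerSaturated` — **the same for every monotone 0/1-valued functional `F` of the open EDGE cluster with `F = 1` on `{s↔y}`**
  (every edge up-set containing the marker event; via `…CrossReachMarkerSaturatedEdge.lean`).
With `…ConstsCrossReach.lean` (`U ⊆ {s↔z}` unconditional; `U ⊇ {s↔z}` modulo (F1) = `Consts.crossExchange_F1`, p367568) the `u = z` CROSS members
are kernel on all four pinned quadrants of vertex up-events; the generic class (up-events comparable with neither `{s↔y}` nor `{s↔z}`) is open —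
by linearity `M_j(U) = M_j(U ∩ Y) + M_j(U ∪ Y) − M_j(Y)`, so it is exactly the "convexity across the marker event" `M_j(U∩Y) + M_j(U∪Y) ≥ M_j(Y)`.
[cite: VandenbergHaggstromKahn2005, Thm. 1.1 (pp. 3–5), Thm. 1.3 (p. 6), Thm. 1.4 (p. 7)]
-/

noncomputable section

namespace Summit.CriticalPhenomena.PercolationContinuityZ3.Theorems

open MeasureTheory Set Literature.Probability.LatticeModels Literature.Probability.Percolation
open scoped Classical

namespace Consts

variable {V : Type} [DecidableEq V] [Fintype V] (w : Sym2 V → unitInterval)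

/-- **CROSS at `u = z` on the marker-saturated quadrant, unconditionally.** [cite: VandenbergHaggstromKahn2005, Thm. 1.3 (p. 6), Thm. 1.1 (pp. 3–5)] -/
theorem crossRel_reach_of_markerSaturated (s y z : V) (X : Set V) {𝒰 : Set V → Prop} (h𝒰 : Monotone 𝒰)
    (hy𝒰 : ∀ S : Set V, y ∈ S → 𝒰 S) (F : Set (Sym2 V) → ℝ)
    (hF : ∀ ω : BondConfig V, F (openEdgeCluster ω s) = if 𝒰 {v | (openGraph ω).Reachable s v} then 1 else 0) :
    (0 ≤ polMargin (prodBernoulli w) s y z F (insert z X) X X + polMargin (prodBernoulli w) s y z F X (insert z X) X +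
        polMargin (prodBernoulli w) s y z F X X (insert z X)) ∧
      0 ≤ polMargin (prodBernoulli w) s y z F (insert z X) (insert z X) X +
          polMargin (prodBernoulli w) s y z F (insert z X) X (insert z X) +
        polMargin (prodBernoulli w) s y z F X (insert z X) (insert z X) := by
  have hmono : Monotone (fun S : Set V => y ∈ S) := fun S S' h hy => h hy
  have hread : ∀ ω : BondConfig V, ∀ (inst : Decidable ((fun S : Set V => y ∈ S) {v | (openGraph ω).Reachable s v})),
      connIndicatorFn s y (openEdgeCluster ω s) = @ite ℝ _ inst 1 0 := by
    intro ω inst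
    rw [connIndicatorFn_openEdgeCluster]
    by_cases h : (openGraph ω).Reachable s y
    · rw [indicator_of_mem (show ω ∈ openConn s y from h), Pi.one_apply, if_pos (show y ∈ {v | (openGraph ω).Reachable s v} from h)]
    · rw [indicator_of_notMem (show ω ∉ openConn s y from h), if_neg (show y ∉ {v | (openGraph ω).Reachable s v} from h)]
  have hY1 := crossRel_reach_M1_of_markerPinned w s y z X hmono (fun S h => h) (connIndicatorFn s y) (fun ω => hread ω _)
  have hY2 := crossRel_reach_M2_of_markerPinned w s y z X hmono (fun S h => h) (connIndicatorFn s y) (fun ω => hread ω _)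
  exact crossRel_reach_of_markerSaturated_of_corner w s y z X h𝒰 hy𝒰 F hF hY1 hY2

/-- **CROSS at `u = z` for every EDGE up-set containing `{s↔y}`, unconditionally.** [cite: VandenbergHaggstromKahn2005, Thm. 1.3 (p. 6), Thm. 1.1 (pp. 3–5)] -/
theorem crossRel_edge_of_markerSaturated (s y z : V) (X : Set V) (F : Set (Sym2 V) → ℝ) (hFm : Monotone F)
    (hF01 : ∀ C, F C = 0 ∨ F C = 1) (hFY : ∀ ω : BondConfig V, (openGraph ω).Reachable s y → F (openEdgeCluster ω s) = 1) :
    (0 ≤ polMargin (prodBernoulli w) s y z F (insert z X) X X + polMargin (prodBernoulli w) s y z F X (insert z X) X +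
        polMargin (prodBernoulli w) s y z F X X (insert z X)) ∧
      0 ≤ polMargin (prodBernoulli w) s y z F (insert z X) (insert z X) X +
          polMargin (prodBernoulli w) s y z F (insert z X) X (insert z X) +
        polMargin (prodBernoulli w) s y z F X (insert z X) (insert z X) := by
  have hmono : Monotone (fun S : Set V => y ∈ S) := fun S S' h hy => h hy
  have hread : ∀ ω : BondConfig V, ∀ (inst : Decidable ((fun S : Set V => y ∈ S) {v | (openGraph ω).Reachable s v})),
      connIndicatorFn s y (openEdgeCluster ω s) = @ite ℝ _ inst 1 0 := by
    intro ω inst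
    rw [connIndicatorFn_openEdgeCluster]
    by_cases h : (openGraph ω).Reachable s y
    · rw [indicator_of_mem (show ω ∈ openConn s y from h), Pi.one_apply, if_pos (show y ∈ {v | (openGraph ω).Reachable s v} from h)]
    · rw [indicator_of_notMem (show ω ∉ openConn s y from h), if_neg (show y ∉ {v | (openGraph ω).Reachable s v} from h)]
  have hY1 := crossRel_reach_M1_of_markerPinned w s y z X hmono (fun S h => h) (connIndicatorFn s y) (fun ω => hread ω _)
  have hY2 := crossRel_reach_M2_of_markerPinned w s y z X hmono (fun S h => h) (connIndicatorFn s y) (fun ω => hread ω _)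
  exact crossRel_edge_of_markerSaturated_of_corner w s y z X F hFm hF01 hFY hY1 hY2

end Consts

end Summit.CriticalPhenomena.PercolationContinuityZ3.Theorems

end
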